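import Literature.NumberTheory.Irrationality.Zudilin2004.Lemma19Padic
import Literature.NumberTheory.Irrationality.Zudilin2004.Lemma19Series
import HarnessLib

/-!
# Zudilin 2004, Lemma 19 for general `𝐡`, V: the arithmetic assembly — `lemma19_holds`

Topic `Literature/NumberTheory/Irrationality/Zudilin2004`. Last file of the DISCHARGE of the named fact
`Literature.NumberTheory.Irrationality.Zudilin2004.lemma19` (`GeneralOddZetaForms.lean`): following
[Zudilin2004, §8, proof of Lemma 19] (arXiv:math/0206176 p. 20) prime by prime.

* `HParams.Gk_eq_pow_mul`, `HParams.B_eq_zero_of_lt`, `HParams.pole_range_of_B_ne_zero` — `B_{jk} = 0` unless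
  `h_j ≤ k ≤ h₀ − h_j` (the reciprocal bricks without a pole at `−k` leave a factor `(t+k)` each), which is
  why the printed sums run over `k = h_j, …, h₀ − h_j` and why `D_{m₁}^r D_{m₂}⋯D_{m_{j−r}} Σ_{l ≤ k−h₁} l^{−(j−1)} ∈ ℤ`
  (`k − h₁ ≤ h₀ − h₁ − h_j ≤ m_{j−r}`);
* `HParams.lcm_dvd` — `D_{m₀}^{q−r−s} · D_K^{s+r−1} ∣ D_{m₁}^r D_{m₂}⋯D_{m_{q−r}}` for `K ≤ m_s` (the «fairly rough»
  inclusions of the printed proof);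
* `HParams.padicValNat_Phi` — `ord_p Φ(𝐡) = ν_p` for `√h₀ < p ≤ m_{q−r}`, `0` otherwise;
* `HParams.padicOrdGe_term` — the heart: for every prime `p`,
  `ord_p (D_{m₁}^r D_{m₂}⋯D_{m_{q−r}} · C · B_{s,k} · H) ≥ ord_p Φ` (`H = 1` or `H = H_{k−h₁}^{(s+r−1)}`): for the primes
  of `Φ` by (8.11) (`Lemma19Padic.lean`) and `ord_p D_{m_i} = 1`, for the other primes by (8.10) and `lcm_dvd`;
* `HParams.qZeta_integral`, `HParams.qConst_integral`, and **`lemma19_holds : lemma19`** (with `Fwp_eq` of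
  `Lemma19Series.lean`, the vanishing of the even and the `s = 1` coefficients, and the reindexing `j = s + r − 1`).

Everything here is PROVED; the net effect is the discharge of one named fact (D-0026).

## References

* [Zudilin2004] W. Zudilin, *Arithmetic of linear forms involving odd zeta values*, J. Théor. Nombres Bordeaux
  16 (2004), 251–291 = arXiv:math/0206176, §8 (8.8)–(8.12), Lemma 19 and its proof.
-/

noncomputable section

open Finset Filter Topology Literature.Analysis.Calculus
open scoped Nat

namespace Literature.NumberTheory.Irrationality.Zudilin2004

open Literature.NumberTheory.Transcendental
open Literature.NumberTheory.Transcendental.Zudilin2004 (Hsum padicValNat_lcmUpto padicValNat_prod_prime_pow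
  padicOrdGe_Hsum padicValNat_lcmUpto_le_one padicOrdGe_inv_natCast)

namespace HParams

variable (P : HParams)

/-! ### Order of vanishing of `Gk P k` at `−k` -/

/-- The number of reciprocal bricks `R(h_j,h₀−h_j+1;t)`, `j > r`, WITHOUT a pole at `t = −k` (each contributes a
factor `t + k` to `Gk P k`). [cite: Zudilin2004, §8 Lemma 19 (proof)] -/
def regCount (k : ℕ) : ℕ :=
  ((Icc (P.r + 1) P.q).filter fun j =>
    ¬((P.h j : ℤ) ≤ (k : ℤ) ∧ ((k : ℕ) : ℤ) < (P.h j : ℤ) + ((P.h 0 - 2 * P.h j + 1 : ℕ) : ℤ))).card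

/-- `Gk P k` has a zero of order `≥ regCount k` at `−k`: `Gk P k t = (t + k)^{regCount k} · g(t)` with `g` smooth at
`−k`. [cite: Zudilin2004, §8 Lemma 19 (proof)] -/
theorem Gk_eq_pow_mul (k : ℕ) : ∃ g : ℚ → ℚ, ContDiffAt ℚ (⊤ : ℕ∞) g (-(k : ℚ)) ∧
    ∀ t : ℚ, P.Gk k t = (t - (-(k : ℚ))) ^ P.regCount k * g t := by
  classical
  set g : ℚ → ℚ := fun t => ((P.h 0 : ℚ) + 2 * t) *
    (∏ j ∈ Icc 1 P.r, polyBrick 1 (P.h j - 1) t) *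
    (∏ j ∈ Icc 1 P.r, polyBrick ((P.h 0 - P.h j + 1 : ℕ) : ℤ) (P.h j - 1) t) *
    ∏ j ∈ Icc (P.r + 1) P.q, ((((P.h 0 - 2 * P.h j + 1 - 1)! : ℚ)) *
      ∏ l ∈ (range (P.h 0 - 2 * P.h j + 1)).filter (fun l : ℕ => (P.h j : ℤ) + (l : ℤ) ≠ k),
        (t + ((((P.h j : ℤ)) + (l : ℤ) : ℤ) : ℚ))⁻¹) with hg
  refine ⟨g, ?_, fun t => ?_⟩
  · -- smoothness at `−k`
    have hpoly : ∀ (b : ℤ) (m : ℕ), ContDiffAt ℚ (⊤ : ℕ∞) (polyBrick b m) (-(k : ℚ)) := by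
      intro b m
      have : polyBrick b m = fun t : ℚ => (∏ l ∈ range m, (t + (b : ℚ) + (l : ℚ))) / (m ! : ℚ) := rfl
      rw [this]
      exact (contDiffAt_prod fun l _ => (contDiffAt_id.add contDiffAt_const).add contDiffAt_const).div_const _
    refine ((((contDiffAt_const).add (contDiffAt_const.mul contDiffAt_id)).mul
      (contDiffAt_prod fun j _ => hpoly _ _)).mul (contDiffAt_prod fun j _ => hpoly _ _)).mul
      (contDiffAt_prod fun j _ => ?_)
    refine contDiffAt_const.mul (contDiffAt_prod fun l hl => ?_)
    have hl' := (mem_filter.1 hl).2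
    refine contDiffAt_inv_add_const ?_
    rw [show (-(k : ℚ) + ((((P.h j : ℤ)) + (l : ℤ) : ℤ) : ℚ)) = (((P.h j : ℤ) + (l : ℤ) - k : ℤ) : ℚ) by
      push_cast; ring]
    exact_mod_cast sub_ne_zero.2 hl'
  · -- the factorisation
    have hprod : ∏ j ∈ Icc (P.r + 1) P.q, recipBrickReg (P.h j : ℤ) (P.h 0 - 2 * P.h j + 1) (k : ℤ) t
        = (∏ j ∈ Icc (P.r + 1) P.q, ((((P.h 0 - 2 * P.h j + 1 - 1)! : ℚ)) *
            ∏ l ∈ (range (P.h 0 - 2 * P.h j + 1)).filter (fun l : ℕ => (P.h j : ℤ) + (l : ℤ) ≠ k),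
              (t + ((((P.h j : ℤ)) + (l : ℤ) : ℤ) : ℚ))⁻¹))
          * ∏ j ∈ Icc (P.r + 1) P.q, (if (P.h j : ℤ) ≤ (k : ℤ) ∧ ((k : ℕ) : ℤ) < (P.h j : ℤ)
              + ((P.h 0 - 2 * P.h j + 1 : ℕ) : ℤ) then (1 : ℚ) else (t + k)) := by
      rw [← prod_mul_distrib]
      rfl
    have hite : ∏ j ∈ Icc (P.r + 1) P.q, (if (P.h j : ℤ) ≤ (k : ℤ) ∧ ((k : ℕ) : ℤ) < (P.h j : ℤ)
        + ((P.h 0 - 2 * P.h j + 1 : ℕ) : ℤ) then (1 : ℚ) else (t + k)) = (t - (-(k : ℚ))) ^ P.regCount k := by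
      rw [prod_ite, prod_const_one, one_mul, prod_const]
      congr 1
      ring
    rw [Gk, hprod, hite, hg]
    ring

variable {P}

/-- **Vanishing of low divided derivatives**: `B P s k = 0` for `q − r − s < regCount k`.
[cite: Zudilin2004, §8 Lemma 19 (proof)] -/
theorem B_eq_zero_of_lt {k s : ℕ} (h : P.q - P.r - s < P.regCount k) : P.B s k = 0 := by
  obtain ⟨g, hg, hG⟩ := P.Gk_eq_pow_mul k
  have hfun : P.Gk k = fun t => (t - (-(k : ℚ))) ^ P.regCount k * g t := funext hG
  rw [B]
  set N := P.q - P.r - s with hN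
  have hg' : ContDiffAt ℚ N g (-(k : ℚ)) := hg.of_le (mod_cast le_top)
  rw [hfun, divDeriv_sub_pow_mul hg' _, if_pos h]

/-- **`B_{jk} ≠ 0` only for `h_j ≤ k ≤ h₀ − h_j`** (`j = r + s`): the printed summation range. [cite: Zudilin2004, §8 Lemma 19 (proof)] -/
theorem pole_range_of_B_ne_zero (hV : P.Valid) {k s : ℕ} (hs : s ∈ Icc 1 (P.q - P.r)) (hB : P.B s k ≠ 0) :
    P.h (P.r + s) ≤ k ∧ k ≤ P.h 0 - P.h (P.r + s) := by
  have hrq := hV.r_add_four_le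
  have hs' := mem_Icc.1 hs
  by_contra hcon
  apply hB
  apply B_eq_zero_of_lt
  unfold regCount
  have hsub : Icc (P.r + s) P.q ⊆ (Icc (P.r + 1) P.q).filter (fun j =>
      ¬((P.h j : ℤ) ≤ (k : ℤ) ∧ ((k : ℕ) : ℤ) < (P.h j : ℤ) + ((P.h 0 - 2 * P.h j + 1 : ℕ) : ℤ))) := by
    intro j hj
    have hj' := mem_Icc.1 hj
    refine mem_filter.2 ⟨mem_Icc.2 ⟨by omega, hj'.2⟩, ?_⟩
    have hmono : P.h (P.r + s) ≤ P.h j := hV.h_mono (by omega) hj'.1 hj'.2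
    have h2j := hV.two_mul_h_lt (j := j) (by omega) hj'.2
    rintro ⟨h1, h2⟩
    apply hcon
    constructor <;> omega
  have := card_le_card hsub
  rw [Nat.card_Icc] at this
  omega

/-! ### The moduli -/

/-- `m₀ ≤ m_j`. [cite: Zudilin2004, §8 (before (8.8))] -/
theorem m0_le_mSeq (P : HParams) (j : ℕ) : P.m0 ≤ P.mSeq j := le_max_left _ _

/-- `m_j ≤ m_i` for `1 ≤ i ≤ j ≤ q − r` (the `h_{r+j}` increase). [cite: Zudilin2004, §8 (before (8.8))] -/
theorem mSeq_anti (hV : P.Valid) {i j : ℕ} (hi : 1 ≤ i) (hij : i ≤ j) (hj : j ≤ P.q - P.r) :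
    P.mSeq j ≤ P.mSeq i := by
  have hrq := hV.r_add_four_le
  have := hV.h_mono (i := P.r + i) (j := P.r + j) (by omega) (by omega) (by omega)
  simp only [mSeq]
  omega

/-- **The «fairly rough» inclusions**: `D_{m₀}^{q−r−s} · D_K^{s+r−1} ∣ D_{m₁}^r D_{m₂}⋯D_{m_{q−r}}` for
`1 ≤ s ≤ q − r` and `K ≤ m_s`. [cite: Zudilin2004, §8 Lemma 19 (proof)] -/
theorem lcm_dvd (hV : P.Valid) {s : ℕ} (hs : s ∈ Icc 1 (P.q - P.r)) {K : ℕ} (hK : K ≤ P.mSeq s) :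
    Nat.lcmUpto P.m0 ^ (P.q - P.r - s) * Nat.lcmUpto K ^ (s + P.r - 1) ∣ P.lcmFactor := by
  have hrq := hV.r_add_four_le
  have hr1 := hV.one_le_r
  have hs' := mem_Icc.1 hs
  have hK1 : K ≤ P.mSeq 1 := hK.trans (mSeq_anti hV le_rfl hs'.1 hs'.2)
  unfold lcmFactor
  have hsplit : Icc 2 (P.q - P.r) = Icc 2 s ∪ Icc (s + 1) (P.q - P.r) := by
    ext j; simp only [mem_Icc, mem_union]; omega
  have hdisj : Disjoint (Icc 2 s) (Icc (s + 1) (P.q - P.r)) := by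
    rw [disjoint_left]; intro j hj hj'; have := mem_Icc.1 hj; have := mem_Icc.1 hj'; omega
  rw [hsplit, prod_union hdisj]
  have h1 : Nat.lcmUpto K ^ P.r ∣ Nat.lcmUpto (P.mSeq 1) ^ P.r :=
    pow_dvd_pow_of_dvd (lcmUpto_dvd_lcmUpto hK1) _
  have h2 : Nat.lcmUpto K ^ (s - 1) ∣ ∏ j ∈ Icc 2 s, Nat.lcmUpto (P.mSeq j) := by
    have : Nat.lcmUpto K ^ (s - 1) = ∏ j ∈ Icc 2 s, Nat.lcmUpto K := by
      rw [prod_const, Nat.card_Icc, show s + 1 - 2 = s - 1 by omega]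
    rw [this]
    exact prod_dvd_prod_of_dvd _ _ fun j hj =>
      lcmUpto_dvd_lcmUpto (hK.trans (mSeq_anti hV (by have := mem_Icc.1 hj; omega) (mem_Icc.1 hj).2 hs'.2))
  have h3 : Nat.lcmUpto P.m0 ^ (P.q - P.r - s) ∣ ∏ j ∈ Icc (s + 1) (P.q - P.r), Nat.lcmUpto (P.mSeq j) := by
    have : Nat.lcmUpto P.m0 ^ (P.q - P.r - s) = ∏ j ∈ Icc (s + 1) (P.q - P.r), Nat.lcmUpto P.m0 := by
      rw [prod_const, Nat.card_Icc, show P.q - P.r + 1 - (s + 1) = P.q - P.r - s by omega]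
    rw [this]
    exact prod_dvd_prod_of_dvd _ _ fun j _ => lcmUpto_dvd_lcmUpto (m0_le_mSeq P j)
  have e : Nat.lcmUpto P.m0 ^ (P.q - P.r - s) * Nat.lcmUpto K ^ (s + P.r - 1)
      = Nat.lcmUpto K ^ P.r * (Nat.lcmUpto K ^ (s - 1) * Nat.lcmUpto P.m0 ^ (P.q - P.r - s)) := by
    rw [show s + P.r - 1 = P.r + (s - 1) by omega, pow_add]; ring
  rw [e]
  exact mul_dvd_mul h1 (mul_dvd_mul h2 h3)

/-! ### Valuations -/

/-- `Φ(𝐡) > 0`. [cite: Zudilin2004, §8 (8.8)] -/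
theorem Phi_pos (P : HParams) : 0 < P.Phi :=
  prod_pos fun _ hp => pow_pos (mem_filter.1 hp).2.1.pos _

/-- `ord_p Φ(𝐡) = ν_p` for the primes `p ≤ m_{q−r}` with `p² > h₀`, `= 0` otherwise. [cite: Zudilin2004, §8 (8.8)] -/
theorem padicValNat_Phi (P : HParams) (p : ℕ) [hp : Fact p.Prime] :
    padicValNat p P.Phi = if p ≤ P.mSeq (P.q - P.r) ∧ P.h 0 < p ^ 2 then (P.nuP p).toNat else 0 := by
  unfold Phi
  rw [padicValNat_prod_prime_pow _ (fun q hq => (mem_filter.1 hq).2.1) (fun q => (P.nuP q).toNat)]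
  by_cases h : p ≤ P.mSeq (P.q - P.r) ∧ P.h 0 < p ^ 2
  · rw [if_pos h, if_pos (mem_filter.2 ⟨mem_range.2 (by omega), hp.out, h.2⟩)]
  · rw [if_neg h, if_neg]
    intro hm
    have hm' := mem_filter.1 hm
    have := mem_range.1 hm'.1
    exact h ⟨by omega, hm'.2.2⟩

/-- `ord_p D_N ≥ 1` for `p ≤ N`. [cite: Zudilin2004, §7 (before Lemma 17: ord_p D_N = 1 for √N < p ≤ N)] -/
theorem padicOrdGe_lcmUpto_of_le {p N : ℕ} [hp : Fact p.Prime] (h : p ≤ N) :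
    PadicOrdGe p 1 ((Nat.lcmUpto N : ℚ)) := by
  refine PadicOrdGe.of_eq ?_
  rw [padicValRat.of_nat, padicValNat_lcmUpto]
  have : 1 ≤ Nat.log p N := Nat.succ_le_of_lt (Nat.log_pos hp.out.one_lt h)
  exact_mod_cast this

/-- `ord_p (D_{m₁}^r D_{m₂}⋯D_{m_{q−r}}) ≥ q − 1` for `p ≤ m_{q−r}`. [cite: Zudilin2004, §8 Lemma 19 (proof)] -/
theorem padicOrdGe_lcmFactor (hV : P.Valid) {p : ℕ} [hp : Fact p.Prime] (h : p ≤ P.mSeq (P.q - P.r)) :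
    PadicOrdGe p ((P.q : ℤ) - 1) ((P.lcmFactor : ℚ)) := by
  have hrq := hV.r_add_four_le
  have hle : ∀ j ∈ Icc 1 (P.q - P.r), p ≤ P.mSeq j := fun j hj =>
    h.trans (mSeq_anti hV (mem_Icc.1 hj).1 (mem_Icc.1 hj).2 le_rfl)
  unfold lcmFactor
  push_cast
  have h1 := (padicOrdGe_lcmUpto_of_le (hle 1 (mem_Icc.2 ⟨le_rfl, by omega⟩))).pow P.r
  have h2 := PadicOrdGe.prod (p := p) (s := Icc 2 (P.q - P.r)) (v := fun _ => (1 : ℤ))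
    (f := fun j => ((Nat.lcmUpto (P.mSeq j)) : ℚ))
    fun j hj => padicOrdGe_lcmUpto_of_le (hle j (mem_Icc.2 ⟨by have := mem_Icc.1 hj; omega, (mem_Icc.1 hj).2⟩))
  refine (h1.mul h2).mono (le_of_eq ?_)
  simp only [sum_const, Nat.card_Icc, nsmul_eq_mul, mul_one]
  omega

/-- `D_K^e · H_K^{(e)} ∈ ℤ`. [cite: Zudilin2004, §8 Lemma 19 (proof)] -/
theorem exists_int_lcm_pow_mul_Hsum (K e : ℕ) : ∃ z : ℤ, (Nat.lcmUpto K : ℚ) ^ e * (Hsum K e : ℚ) = z := by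
  refine ⟨((∑ l ∈ Icc 1 K, (Nat.lcmUpto K / l) ^ e : ℕ) : ℤ), ?_⟩
  unfold Hsum
  rw [mul_sum, Int.cast_natCast]
  push_cast
  refine sum_congr rfl fun l hl => ?_
  have hl' := mem_Icc.1 hl
  have hl0 : (l : ℚ) ≠ 0 := by exact_mod_cast (show l ≠ 0 by omega)
  rw [Nat.cast_div (dvd_lcmUpto hl'.1 hl'.2) hl0, div_pow, div_eq_mul_inv]

/-! ### The `p`-adic heart of Lemma 19 -/

/-- **The term-by-term estimate**: for every prime `p`, `1 ≤ s ≤ q − r`, `k ∈ poleSet` and a factor `H` with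
`D_K^e H ∈ ℤ`, `ord_p H ≥ −e·ord_p D_K`, where `K < h₀`, `e ≤ s + r − 1` and `K ≤ m_s` whenever `B P s k ≠ 0`
(`H = 1` with `K = e = 0`, or `H = H_{k−h₁}^{(s+r−1)}` with `K = k − h₁`):
`ord_p (D_{m₁}^r D_{m₂}⋯D_{m_{q−r}} · C(s+r−2,r−1) · B P s k · H) ≥ ord_p Φ(𝐡)`. [cite: Zudilin2004, §8 Lemma 19 (proof)] -/
theorem padicOrdGe_term (hV : P.Valid) {p : ℕ} [hp : Fact p.Prime] {k s : ℕ} (hk : k ∈ P.poleSet)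
    (hs : s ∈ Icc 1 (P.q - P.r)) {H : ℚ} {K e : ℕ} (hKe : P.B s k ≠ 0 → K ≤ P.mSeq s) (hK2 : K < P.h 0)
    (he : e ≤ s + P.r - 1) (hHint : ∃ z : ℤ, (Nat.lcmUpto K : ℚ) ^ e * H = z)
    (hHord : PadicOrdGe p (-((e * padicValNat p (Nat.lcmUpto K) : ℕ) : ℤ)) H) :
    PadicOrdGe p (padicValNat p P.Phi)
      ((P.lcmFactor : ℚ) * ((((s + P.r - 2).choose (P.r - 1) : ℕ) : ℚ) * P.B s k * H)) := by
  have hrq := hV.r_add_four_le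
  have hr1 := hV.one_le_r
  have hs' := mem_Icc.1 hs
  have hk' := mem_Icc.1 hk
  rw [padicValNat_Phi]
  by_cases hΦ : p ≤ P.mSeq (P.q - P.r) ∧ P.h 0 < p ^ 2
  · -- the primes of `Φ`: (8.11)
    rw [if_pos hΦ, Int.toNat_of_nonneg (P.nuP_nonneg p)]
    have hL := padicOrdGe_lcmFactor hV hΦ.1
    have hC : PadicOrdGe p 0 ((((s + P.r - 2).choose (P.r - 1) : ℕ) : ℚ)) := PadicOrdGe.of_nat _
    have hB : PadicOrdGe p (P.nuP p - ((P.q - P.r - s : ℕ) : ℤ)) (P.B s k) :=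
      (padicOrdGe_divDeriv_Gk hV p hΦ.2 hk'.1 hk'.2 (P.q - P.r - s)).mono
        (by have := P.nuP_le_nuKP p hk; omega)
    have hv1 : padicValNat p (Nat.lcmUpto K) ≤ 1 := padicValNat_lcmUpto_le_one (hK2.trans hΦ.2)
    have h := ((hL.mul hC).mul hB).mul hHord
    rw [show (P.lcmFactor : ℚ) * ((((s + P.r - 2).choose (P.r - 1) : ℕ) : ℚ) * P.B s k * H)
      = (P.lcmFactor : ℚ) * (((s + P.r - 2).choose (P.r - 1) : ℕ) : ℚ) * P.B s k * H by ring]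
    refine h.mono ?_
    rcases Nat.le_one_iff_eq_zero_or_eq_one.1 hv1 with hv | hv <;>
    · rw [hv]; push_cast; omega
  · -- the other primes: integrality, by (8.10) and `lcm_dvd`
    rw [if_neg hΦ, Nat.cast_zero]
    by_cases hB0 : P.B s k = 0
    · rw [hB0, mul_zero, zero_mul, mul_zero]; exact PadicOrdGe.zero _
    obtain ⟨c, hc⟩ := lcm_dvd hV hs (hKe hB0)
    obtain ⟨zB, hzB⟩ := exists_int_lcm_pow_mul_divDeriv_Gk hV hk'.1 hk'.2 (P.q - P.r - s)
    obtain ⟨zH, hzH⟩ := hHint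
    have e1 : (P.lcmFactor : ℚ) * ((((s + P.r - 2).choose (P.r - 1) : ℕ) : ℚ) * P.B s k * H)
        = (((c * Nat.lcmUpto K ^ (s + P.r - 1 - e) * (s + P.r - 2).choose (P.r - 1) : ℕ) : ℤ) : ℚ) * zB * zH := by
      rw [hc, ← hzB, ← hzH, B]
      push_cast
      rw [show ((Nat.lcmUpto K : ℚ)) ^ (s + P.r - 1) = (Nat.lcmUpto K : ℚ) ^ e * (Nat.lcmUpto K : ℚ) ^ (s + P.r - 1 - e)
        by rw [← pow_add]; congr 1; omega]
      ring
    rw [e1]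
    have h := ((PadicOrdGe.of_int (p := p)
      ((c * Nat.lcmUpto K ^ (s + P.r - 1 - e) * (s + P.r - 2).choose (P.r - 1) : ℕ) : ℤ)).mul
      (PadicOrdGe.of_int (p := p) zB)).mul (PadicOrdGe.of_int (p := p) zH)
    exact h.mono (by norm_num)

/-- From `ord_p X ≥ ord_p Φ` for all `p` to `X · Φ⁻¹` having non-negative order. [cite: Zudilin2004, §8 Lemma 19 (proof)] -/
theorem padicOrdGe_mul_inv_Phi {p : ℕ} [Fact p.Prime] {X : ℚ} (h : PadicOrdGe p (padicValNat p P.Phi) X) :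
    PadicOrdGe p 0 (X * ((P.Phi : ℚ))⁻¹) := by
  simpa using h.mul (padicOrdGe_inv_natCast P.Phi)

/-- **[Zudilin2004, Lemma 19] for the coefficient of `ζ(s+r−1)`**: `D_{m₁}^r D_{m₂}⋯D_{m_{q−r}} · qZeta P s = Φ · (integer)`.
[cite: Zudilin2004, §8 Lemma 19] -/
theorem qZeta_integral (hV : P.Valid) {s : ℕ} (hs : s ∈ Icc 1 (P.q - P.r)) :
    ∃ z : ℤ, (P.lcmFactor : ℚ) * P.qZeta s = P.Phi * z := by
  have hΦ0 : (P.Phi : ℚ) ≠ 0 := by exact_mod_cast (Phi_pos P).ne'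
  have h0 : 0 < P.h 0 := hV.one_le_h (j := 0) (Nat.zero_le _)
  obtain ⟨z, hz⟩ := Rat.exists_int_of_padicOrdGe (q := (P.lcmFactor : ℚ) * P.qZeta s * ((P.Phi : ℚ))⁻¹)
    fun p hp => by
      haveI : Fact p.Prime := ⟨hp⟩
      unfold qZeta
      have e : (P.lcmFactor : ℚ) * ((((s + P.r - 2).choose (P.r - 1) : ℕ) : ℚ) * ∑ k ∈ P.poleSet, P.B s k) *
          ((P.Phi : ℚ))⁻¹
          = ∑ k ∈ P.poleSet, (P.lcmFactor : ℚ) * ((((s + P.r - 2).choose (P.r - 1) : ℕ) : ℚ) * P.B s k * 1) *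
            ((P.Phi : ℚ))⁻¹ := by
        rw [mul_sum, mul_sum, sum_mul]
        exact sum_congr rfl fun k _ => by ring
      rw [e]
      refine PadicOrdGe.sum fun k hk => padicOrdGe_mul_inv_Phi (p := p) ?_
      exact padicOrdGe_term hV hk hs (H := 1) (K := 0) (e := 0) (fun _ => Nat.zero_le _) h0 (Nat.zero_le _)
        ⟨1, by simp⟩ (by simpa using PadicOrdGe.of_int (p := p) 1)
  refine ⟨z, ?_⟩
  rw [← hz]
  field_simp

/-- **[Zudilin2004, Lemma 19] for the constant term**: `D_{m₁}^r D_{m₂}⋯D_{m_{q−r}} · qConst P = Φ · (integer)`.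
[cite: Zudilin2004, §8 Lemma 19] -/
theorem qConst_integral (hV : P.Valid) : ∃ z : ℤ, (P.lcmFactor : ℚ) * P.qConst = P.Phi * z := by
  have hΦ0 : (P.Phi : ℚ) ≠ 0 := by exact_mod_cast (Phi_pos P).ne'
  have hrq := hV.r_add_four_le
  have h1 := hV.one_le_h (j := P.r + 1) (by omega)
  obtain ⟨z, hz⟩ := Rat.exists_int_of_padicOrdGe (q := (P.lcmFactor : ℚ) * P.qConst * ((P.Phi : ℚ))⁻¹)
    fun p hp => by
      haveI : Fact p.Prime := ⟨hp⟩
      unfold qConst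
      have e : (P.lcmFactor : ℚ) * (-∑ k ∈ P.poleSet, ∑ s ∈ Icc 1 (P.q - P.r),
            ((((s + P.r - 2).choose (P.r - 1) : ℕ) : ℚ) * P.B s k * Hsum (k - P.h 1) (s + P.r - 1))) *
            ((P.Phi : ℚ))⁻¹
          = ∑ k ∈ P.poleSet, ∑ s ∈ Icc 1 (P.q - P.r), -((P.lcmFactor : ℚ) *
            ((((s + P.r - 2).choose (P.r - 1) : ℕ) : ℚ) * P.B s k * Hsum (k - P.h 1) (s + P.r - 1)) *
              ((P.Phi : ℚ))⁻¹) := by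
        rw [mul_neg, neg_mul, mul_sum, sum_mul, ← sum_neg_distrib]
        refine sum_congr rfl fun k _ => ?_
        rw [mul_sum, sum_mul, ← sum_neg_distrib]
      rw [e]
      refine PadicOrdGe.sum fun k hk => PadicOrdGe.sum fun s hs => ?_
      have hk' := mem_Icc.1 hk
      have h := padicOrdGe_term hV hk hs (K := k - P.h 1) (e := s + P.r - 1)
        (H := Hsum (k - P.h 1) (s + P.r - 1))
        (fun hB => by
          have := pole_range_of_B_ne_zero hV hs hB
          simp only [mSeq]
          omega)
        (by omega) le_rfl (exists_int_lcm_pow_mul_Hsum _ _) (padicOrdGe_Hsum (p := p) _ _)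
      simpa using (PadicOrdGe.of_int (p := p) (-1)).mul (padicOrdGe_mul_inv_Phi (p := p) h)
  refine ⟨z, ?_⟩
  rw [← hz]
  field_simp

end HParams

/-- **[Zudilin2004, Lemma 19]** for a GENERAL parameter set `𝐡` — the discharge of the named fact
`Literature.NumberTheory.Irrationality.Zudilin2004.lemma19`: for odd `q ≥ r + 4` and positive integers
`𝐡 = (h₀;h₁,…,h_q)` with (8.1) and `h₁ ≤ ⋯ ≤ h_q < h₀/2`, there are integers `Z₀` and `Z_j` (`j` odd,
`r + 2 ≤ j ≤ q − 2`) with `D_{m₁}^r D_{m₂}⋯D_{m_{q−r}} · F(𝐡) = Φ(𝐡) · (Z₀ + Σ_j Z_j ζ(j))`.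
[cite: Zudilin2004, §8 Lemma 19 (arXiv:math/0206176 p. 20; J. Théor. Nombres Bordeaux 16 (2004) p. 281)] -/
theorem lemma19_holds : lemma19 := by
  intro P hV
  have hrq := hV.r_add_four_le
  have hr1 := hV.one_le_r
  have hΦ0 : (P.Phi : ℚ) ≠ 0 := by exact_mod_cast (HParams.Phi_pos P).ne'
  -- integrality witnesses
  have hZ : ∀ s, ∃ z : ℤ, s ∈ Icc 1 (P.q - P.r) → (P.lcmFactor : ℚ) * P.qZeta s = P.Phi * z := by
    intro s
    by_cases hs : s ∈ Icc 1 (P.q - P.r)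
    · obtain ⟨z, hz⟩ := HParams.qZeta_integral hV hs
      exact ⟨z, fun _ => hz⟩
    · exact ⟨0, fun h => (hs h).elim⟩
  choose zZ hzZ using hZ
  obtain ⟨z0, hz0⟩ := HParams.qConst_integral hV
  set Z : ℕ → ℤ := fun j => if j = 0 then z0 else zZ (j + 1 - P.r) with hZdef
  have hZ0 : Z 0 = z0 := if_pos rfl
  have hZj : ∀ j, j ≠ 0 → Z j = zZ (j + 1 - P.r) := fun j hj => if_neg hj
  refine ⟨Z, ?_⟩
  rw [HParams.Fwp_eq hV, hZ0]
  -- even `s` contribute nothing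
  have hzero : ∀ s ∈ Icc 2 (P.q - P.r), Even s → zZ s = 0 := by
    intro s hs hev
    have hs1 : s ∈ Icc 1 (P.q - P.r) := by
      have := mem_Icc.1 hs
      exact mem_Icc.2 ⟨by omega, this.2⟩
    have h := hzZ s hs1
    rw [HParams.qZeta_eq_zero hV (mem_Icc.1 hs).2 (Or.inr hev), mul_zero] at h
    have : (P.Phi : ℚ) * zZ s = 0 := h.symm
    exact_mod_cast (mul_eq_zero.1 this).resolve_left hΦ0
  -- the left-hand side through the witnesses
  have hL : (P.lcmFactor : ℝ) * (∑ s ∈ Icc 2 (P.q - P.r), (P.qZeta s : ℝ) * zetaValue (s + P.r - 1)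
      + (P.qConst : ℝ)) = (P.Phi : ℝ) * ((z0 : ℝ) + ∑ s ∈ Icc 2 (P.q - P.r), (zZ s : ℝ) * zetaValue (s + P.r - 1)) := by
    have c0 : (P.lcmFactor : ℝ) * (P.qConst : ℝ) = (P.Phi : ℝ) * (z0 : ℝ) := by exact_mod_cast hz0
    have cs : ∀ s ∈ Icc 2 (P.q - P.r), (P.lcmFactor : ℝ) * (P.qZeta s : ℝ) = (P.Phi : ℝ) * (zZ s : ℝ) := by
      intro s hs
      have hs1 : s ∈ Icc 1 (P.q - P.r) := by
        have := mem_Icc.1 hs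
        exact mem_Icc.2 ⟨by omega, this.2⟩
      exact_mod_cast hzZ s hs1
    have hsum : (P.lcmFactor : ℝ) * ∑ s ∈ Icc 2 (P.q - P.r), (P.qZeta s : ℝ) * zetaValue (s + P.r - 1)
        = (P.Phi : ℝ) * ∑ s ∈ Icc 2 (P.q - P.r), (zZ s : ℝ) * zetaValue (s + P.r - 1) := by
      rw [mul_sum, mul_sum]
      refine sum_congr rfl fun s hs => ?_
      rw [← mul_assoc, cs s hs, mul_assoc]
    rw [mul_add, hsum, c0, mul_add]
    ring
  rw [hL]
  congr 1
  congr 1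
  -- drop the even `s`, then reindex `j = s + r − 1`
  have hfilt : ∑ s ∈ Icc 2 (P.q - P.r), (zZ s : ℝ) * zetaValue (s + P.r - 1)
      = ∑ s ∈ (Icc 2 (P.q - P.r)).filter Odd, (zZ s : ℝ) * zetaValue (s + P.r - 1) := by
    rw [sum_filter_of_ne]
    intro s hs hne
    by_contra hodd
    apply hne
    rw [hzero s hs (Nat.not_odd_iff_even.1 hodd)]
    simp
  rw [hfilt]
  obtain ⟨c, hc⟩ := hV.even_q_sub_r
  obtain ⟨e, he⟩ := hV.even_r_sub_one
  refine sum_nbij' (fun s => s + P.r - 1) (fun j => j + 1 - P.r) ?_ ?_ ?_ ?_ ?_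
  · intro s hs
    have hs' := mem_filter.1 hs
    have := mem_Icc.1 hs'.1
    obtain ⟨d, hd⟩ := hs'.2
    exact mem_filter.2 ⟨mem_Icc.2 ⟨by omega, by omega⟩, ⟨d + e, by omega⟩⟩
  · intro j hj
    have hj' := mem_filter.1 hj
    have := mem_Icc.1 hj'.1
    obtain ⟨d, hd⟩ := hj'.2
    exact mem_filter.2 ⟨mem_Icc.2 ⟨by omega, by omega⟩, ⟨d - e, by omega⟩⟩
  · intro s hs
    have := mem_Icc.1 (mem_filter.1 hs).1
    omega
  · intro j hj
    have := mem_Icc.1 (mem_filter.1 hj).1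
    omega
  · intro s hs
    have := mem_Icc.1 (mem_filter.1 hs).1
    rw [hZj _ (by omega), show s + P.r - 1 + 1 - P.r = s by omega]

end Literature.NumberTheory.Irrationality.Zudilin2004
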